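import Mathlib.Analysis.InnerProductSpace.Basic
import Mathlib.MeasureTheory.Integral.IntervalIntegral.Basic
import Mathlib.Analysis.SpecialFunctions.Integrals.Basic

/-!
# Odd persistence: the `Θ`-odd part of a reversibly, isometrically evolved odd vector keeps a fixed fraction of its norm on average

Support file for item `stmt-AtomisticToContinuum-9139` (`OddSectorIrreversibility.OddCorrectorDecay`,
summit AtomisticToContinuum / FouriersLaw), negative side. This is the abstract Hilbert-space core
of the line `odd-persistence-light-cone` of the crux dossier
(`Summits/AtomisticToContinuum/FouriersLaw/Cruxes/OddCorrectorDecay/OddPersistenceCore.lean`,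
crux-ideate round 1, ideator 2), re-proved here in the SEMIGROUP-WITH-REVERSAL form that the
closed Hamiltonian flow of the pinned chain supplies directly (forward flow for `t ≥ 0` plus the
reversibility `φ_t ∘ Θ ∘ φ_t ∘ Θ = id`; no two-sided group is needed):

Let `E` be a real inner-product space, `U t : E →ₗᵢ[ℝ] E` (`t ≥ 0`) linear isometries with
`U (s + t) = U s ∘ U t` for `s, t ≥ 0`, `Θ : E →ₗᵢ[ℝ] E` a linear isometry with the
REVERSIBILITY relation `U t (Θ (U t (Θ x))) = x` (`t ≥ 0`), and `F` an odd vector, `Θ F = -F`.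
* `odd_part_eq`        : `U_t F - Θ U_t F = U_t F + Θ U_t Θ F`;
* `odd_norm_sq`        : `‖U_t F - Θ U_t F‖² = 2‖F‖² + 2⟪U_{2t} F, F⟫` (`t ≥ 0`);
* `odd_dichotomy`      : `‖F‖²/16 ≤ ‖U_tF - ΘU_tF‖²/4 ∨ 11‖F‖²/16 ≤ ‖U_{2t}F - ΘU_{2t}F‖²/4`;
* `odd_sum_ge`         : `‖F‖/4 ≤ ‖U_tF - ΘU_tF‖/2 + ‖U_{2t}F - ΘU_{2t}F‖/2`;
* `odd_persistence_integral` : **`t₀‖F‖/12 ≤ ∫₀^{t₀} ‖U_tF - ΘU_tF‖/2 dt`** for `t₀ ≥ 0`, assuming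
  only interval integrability of `t ↦ ‖U_tF - ΘU_tF‖` on `[0, t₀]`.
No mixing, no spectral theorem: Hilbert-space algebra plus one linear change of variables.
-/

open scoped RealInnerProductSpace
open MeasureTheory Set

namespace Summit.AtomisticToContinuum.FouriersLaw.Theorems.OddPersistence

variable {E : Type*} [NormedAddCommGroup E] [InnerProductSpace ℝ E]

section

variable (U : ℝ → E →ₗᵢ[ℝ] E) (Θ : E →ₗᵢ[ℝ] E) (F : E)
  (hUadd : ∀ s t : ℝ, 0 ≤ s → 0 ≤ t → ∀ x, U (s + t) x = U s (U t x))
  (hrev : ∀ t : ℝ, 0 ≤ t → ∀ x, U t (Θ (U t (Θ x))) = x) (hodd : Θ F = -F)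

include hodd in
/-- The odd part of `U_t F`: `U_t F - Θ U_t F = U_t F + Θ U_t Θ F` (since `Θ F = -F`). [folklore] -/
theorem odd_part_eq (t : ℝ) : U t F - Θ (U t F) = U t F + Θ (U t (Θ F)) := by
  rw [hodd, LinearIsometry.map_neg, LinearIsometry.map_neg, sub_eq_add_neg]

include hUadd hrev in
/-- `⟪U_t F, Θ U_t Θ F⟫ = ⟪U_{2t} F, F⟫` for `t ≥ 0` (isometry + semigroup law + reversibility).
[folklore] -/
theorem inner_forward_backward {t : ℝ} (ht : 0 ≤ t) :
    ⟪U t F, Θ (U t (Θ F))⟫ = ⟪U (2 * t) F, F⟫ := by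
  have h1 : U t (U t F) = U (2 * t) F := by rw [two_mul, hUadd t t ht ht]
  calc ⟪U t F, Θ (U t (Θ F))⟫ = ⟪U t (U t F), U t (Θ (U t (Θ F)))⟫ :=
        ((U t).inner_map_map _ _).symm
    _ = ⟪U (2 * t) F, F⟫ := by rw [h1, hrev t ht F]

include hUadd hrev hodd in
/-- **Odd-norm identity**: `‖U_t F - Θ U_t F‖² = 2‖F‖² + 2⟪U_{2t}F, F⟫` for `t ≥ 0`. [folklore] -/
theorem odd_norm_sq {t : ℝ} (ht : 0 ≤ t) :
    ‖U t F - Θ (U t F)‖ ^ 2 = 2 * ‖F‖ ^ 2 + 2 * ⟪U (2 * t) F, F⟫ := by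
  rw [odd_part_eq U Θ F hodd, norm_add_sq_real, inner_forward_backward U Θ F hUadd hrev ht,
    LinearIsometry.norm_map, LinearIsometry.norm_map, LinearIsometry.norm_map,
    LinearIsometry.norm_map]
  ring

include hUadd hrev hodd in
/-- **Doubling dichotomy**: for every `t ≥ 0`, either the odd part at `t` has squared norm `≥ ‖F‖²/16`,
or the odd part at `2t` has squared norm `≥ 11‖F‖²/16`. [folklore] -/
theorem odd_dichotomy {t : ℝ} (ht : 0 ≤ t) :
    ‖F‖ ^ 2 / 16 ≤ ‖U t F - Θ (U t F)‖ ^ 2 / 4 ∨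
      11 * ‖F‖ ^ 2 / 16 ≤ ‖U (2 * t) F - Θ (U (2 * t) F)‖ ^ 2 / 4 := by
  set a : ℝ := ‖F‖ ^ 2 with ha
  set c₂ : ℝ := ⟪U (2 * t) F, F⟫ with hc₂
  have h_t := odd_norm_sq U Θ F hUadd hrev hodd ht
  have h2t : 0 ≤ 2 * t := by positivity
  by_cases hc : -(7 / 8) * a ≤ c₂
  · left
    rw [h_t]
    nlinarith [hc]
  · right
    push Not at hc
    have h_2t := odd_norm_sq U Θ F hUadd hrev hodd h2t
    -- e := U_{2t} F + F has ‖e‖² = 2a + 2c₂ < a/4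
    set e : E := U (2 * t) F + F with he
    have he_sq : ‖e‖ ^ 2 = 2 * a + 2 * c₂ := by
      rw [he, norm_add_sq_real, LinearIsometry.norm_map, ← ha, ← hc₂]
      ring
    have he_lt : ‖e‖ ^ 2 < a / 4 := by rw [he_sq]; linarith
    have he_norm : ‖e‖ < ‖F‖ / 2 := by
      have h0 : 0 ≤ ‖F‖ / 2 := by positivity
      nlinarith [norm_nonneg e, he_lt, ha]
    -- c₄ = ⟪U_{2t} e, F⟫ - c₂
    have hUF : U (2 * t) F = e - F := by rw [he]; abel
    have hc4 : ⟪U (2 * (2 * t)) F, F⟫ = ⟪U (2 * t) e, F⟫ - c₂ := by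
      have h4 : U (2 * (2 * t)) F = U (2 * t) (U (2 * t) F) := by
        rw [two_mul (2 * t), hUadd _ _ h2t h2t]
      rw [h4, hUF, map_sub, inner_sub_left, ← hc₂]
    have hbound : |⟪U (2 * t) e, F⟫| ≤ ‖e‖ * ‖F‖ := by
      have := abs_real_inner_le_norm (U (2 * t) e) F
      rwa [LinearIsometry.norm_map] at this
    have habs := abs_le.mp hbound
    have hprod : ‖e‖ * ‖F‖ ≤ a / 2 := by
      have hF : 0 ≤ ‖F‖ := norm_nonneg F
      calc ‖e‖ * ‖F‖ ≤ (‖F‖ / 2) * ‖F‖ := mul_le_mul_of_nonneg_right he_norm.le hF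
        _ = a / 2 := by rw [ha]; ring
    rw [h_2t, hc4]
    nlinarith [habs.1, hprod, hc]

include hUadd hrev hodd in
/-- Pointwise consequence: `‖F‖/4 ≤ f(t) + f(2t)` (`t ≥ 0`) for the half-norm
`f(t) = ‖U_tF - ΘU_tF‖/2` of the odd part. [folklore] -/
theorem odd_sum_ge {t : ℝ} (ht : 0 ≤ t) :
    ‖F‖ / 4 ≤ ‖U t F - Θ (U t F)‖ / 2 + ‖U (2 * t) F - Θ (U (2 * t) F)‖ / 2 := by
  have hF : 0 ≤ ‖F‖ / 4 := by positivity
  have h1 : 0 ≤ ‖U t F - Θ (U t F)‖ / 2 := by positivity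
  have h2 : 0 ≤ ‖U (2 * t) F - Θ (U (2 * t) F)‖ / 2 := by positivity
  rcases odd_dichotomy U Θ F hUadd hrev hodd ht with h | h
  · have hsq : (‖F‖ / 4) ^ 2 ≤ (‖U t F - Θ (U t F)‖ / 2) ^ 2 := by nlinarith [h]
    exact le_of_sq_le_sq hsq h1 |>.trans (le_add_of_nonneg_right h2)
  · have hsq : (‖F‖ / 4) ^ 2 ≤ (‖U (2 * t) F - Θ (U (2 * t) F)‖ / 2) ^ 2 := by
      nlinarith [h, sq_nonneg ‖F‖]
    exact le_of_sq_le_sq hsq h2 |>.trans (le_add_of_nonneg_left h1)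

include hUadd hrev hodd in
/-- **Odd persistence, integrated form**: `t₀ ‖F‖ / 12 ≤ ∫₀^{t₀} ‖U_tF - ΘU_tF‖/2 dt` for every
`t₀ ≥ 0`, assuming only that `t ↦ ‖U_tF - ΘU_tF‖` is interval integrable on `[0, t₀]`.
Proof: integrate `f(t) + f(2t) ≥ ‖F‖/4` over `[0, t₀/2]` and substitute `s = 2t` in the second term:
`∫₀^{t₀} f + ½∫₀^{t₀} f ≥ t₀‖F‖/8`. [folklore] -/
theorem odd_persistence_integral {t₀ : ℝ} (ht₀ : 0 ≤ t₀)
    (hfi : IntervalIntegrable (fun t => ‖U t F - Θ (U t F)‖) volume 0 t₀) :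
    t₀ * ‖F‖ / 12 ≤ ∫ t in (0:ℝ)..t₀, ‖U t F - Θ (U t F)‖ / 2 := by
  set f : ℝ → ℝ := fun t => ‖U t F - Θ (U t F)‖ / 2 with hf
  have hfi' : IntervalIntegrable f volume 0 t₀ := hfi.div_const 2
  have hsub : uIcc (0:ℝ) (t₀ / 2) ⊆ uIcc 0 t₀ := by
    rw [uIcc_of_le (by positivity : (0:ℝ) ≤ t₀ / 2), uIcc_of_le ht₀]
    exact Icc_subset_Icc le_rfl (by linarith)
  have hfi_half : IntervalIntegrable f volume 0 (t₀ / 2) := hfi'.mono_set hsub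
  have hf2i : IntervalIntegrable (fun t => f (2 * t)) volume 0 (t₀ / 2) := by
    have h := hfi'.comp_mul_left (c := 2)
    rwa [zero_div] at h
  have hnn : ∀ t, 0 ≤ f t := fun t => by positivity
  -- (1) pointwise bound integrated over [0, t₀/2]
  have hpt : ∀ t ∈ Icc (0:ℝ) (t₀ / 2), ‖F‖ / 4 ≤ f t + f (2 * t) := fun t ht =>
    odd_sum_ge U Θ F hUadd hrev hodd ht.1
  have hI1 : ∫ t in (0:ℝ)..(t₀ / 2), ‖F‖ / 4 ≤ ∫ t in (0:ℝ)..(t₀ / 2), (f t + f (2 * t)) :=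
    intervalIntegral.integral_mono_on (by positivity) intervalIntegrable_const (hfi_half.add hf2i) hpt
  have hconst : ∫ t in (0:ℝ)..(t₀ / 2), ‖F‖ / 4 = (t₀ / 2) * (‖F‖ / 4) := by
    rw [intervalIntegral.integral_const]; simp
  -- (2) split the sum and substitute in the second integral
  have hsplit : ∫ t in (0:ℝ)..(t₀ / 2), (f t + f (2 * t)) =
      (∫ t in (0:ℝ)..(t₀ / 2), f t) + ∫ t in (0:ℝ)..(t₀ / 2), f (2 * t) :=
    intervalIntegral.integral_add hfi_half hf2i
  have hsubst : ∫ t in (0:ℝ)..(t₀ / 2), f (2 * t) = (1 / 2) * ∫ t in (0:ℝ)..t₀, f t := by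
    have h := intervalIntegral.integral_comp_mul_left f (two_ne_zero : (2:ℝ) ≠ 0) (a := 0) (b := t₀ / 2)
    rw [h]
    have : (2:ℝ) * (t₀ / 2) = t₀ := by ring
    rw [mul_zero, this, smul_eq_mul]
    norm_num
  -- (3) the half-interval integral is at most the full one (f ≥ 0)
  have hmono : ∫ t in (0:ℝ)..(t₀ / 2), f t ≤ ∫ t in (0:ℝ)..t₀, f t :=
    intervalIntegral.integral_mono_interval le_rfl (by linarith) (by linarith)
      (Filter.Eventually.of_forall fun t => hnn t) hfi'
  -- (4) conclude
  have key : (t₀ / 2) * (‖F‖ / 4) ≤ (∫ t in (0:ℝ)..t₀, f t) + (1 / 2) * ∫ t in (0:ℝ)..t₀, f t := by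
    calc (t₀ / 2) * (‖F‖ / 4) = ∫ t in (0:ℝ)..(t₀ / 2), ‖F‖ / 4 := hconst.symm
      _ ≤ ∫ t in (0:ℝ)..(t₀ / 2), (f t + f (2 * t)) := hI1
      _ = (∫ t in (0:ℝ)..(t₀ / 2), f t) + ∫ t in (0:ℝ)..(t₀ / 2), f (2 * t) := hsplit
      _ ≤ (∫ t in (0:ℝ)..t₀, f t) + (1 / 2) * ∫ t in (0:ℝ)..t₀, f t := by rw [hsubst]; linarith
  have : t₀ * ‖F‖ / 12 ≤ ∫ t in (0:ℝ)..t₀, f t := by nlinarith [key]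
  simpa [hf] using this

include hUadd hrev hodd in
/-- **Odd persistence against a nearby orbit.** If `a : ℝ → E` is any curve with
`‖a t - U t F‖ ≤ δ` on `[0, t₀]` (`t₀ ≥ 0`) and both `t ↦ ‖U_tF - ΘU_tF‖` and `t ↦ ‖a t - Θ (a t)‖`
are interval integrable on `[0, t₀]`, then `t₀ (‖F‖/6 - 2δ) ≤ ∫₀^{t₀} ‖a t - Θ (a t)‖ dt`:
the odd part of `a` inherits the persistence of the odd part of the isometric orbit, up to `2δ`
per unit time (`‖a - Θa‖ ≥ ‖U_tF - ΘU_tF‖ - 2‖a - U_tF‖`). [folklore] -/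
theorem odd_persistence_of_near {t₀ δ : ℝ} (ht₀ : 0 ≤ t₀) (a : ℝ → E)
    (hnear : ∀ t ∈ Icc (0:ℝ) t₀, ‖a t - U t F‖ ≤ δ)
    (hfi : IntervalIntegrable (fun t => ‖U t F - Θ (U t F)‖) volume 0 t₀)
    (hai : IntervalIntegrable (fun t => ‖a t - Θ (a t)‖) volume 0 t₀) :
    t₀ * (‖F‖ / 6 - 2 * δ) ≤ ∫ t in (0:ℝ)..t₀, ‖a t - Θ (a t)‖ := by
  have hpt : ∀ t ∈ Icc (0:ℝ) t₀, ‖U t F - Θ (U t F)‖ - 2 * δ ≤ ‖a t - Θ (a t)‖ := by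
    intro t ht
    have h1 : ‖U t F - Θ (U t F)‖ ≤ ‖a t - Θ (a t)‖ + ‖(a t - U t F) - Θ (a t - U t F)‖ := by
      have e : U t F - Θ (U t F) = (a t - Θ (a t)) - ((a t - U t F) - Θ (a t - U t F)) := by
        rw [map_sub]; abel
      rw [e]
      exact norm_sub_le _ _
    have h2 : ‖(a t - U t F) - Θ (a t - U t F)‖ ≤ 2 * δ := by
      calc ‖(a t - U t F) - Θ (a t - U t F)‖ ≤ ‖a t - U t F‖ + ‖Θ (a t - U t F)‖ := norm_sub_le _ _
        _ = ‖a t - U t F‖ + ‖a t - U t F‖ := by rw [LinearIsometry.norm_map]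
        _ ≤ δ + δ := add_le_add (hnear t ht) (hnear t ht)
        _ = 2 * δ := by ring
    linarith
  have hper := odd_persistence_integral U Θ F hUadd hrev hodd ht₀ hfi
  have hI : ∫ t in (0:ℝ)..t₀, (‖U t F - Θ (U t F)‖ - 2 * δ) ≤ ∫ t in (0:ℝ)..t₀, ‖a t - Θ (a t)‖ :=
    intervalIntegral.integral_mono_on ht₀ (hfi.sub intervalIntegrable_const) hai hpt
  have hsplit : ∫ t in (0:ℝ)..t₀, (‖U t F - Θ (U t F)‖ - 2 * δ) =
      (∫ t in (0:ℝ)..t₀, ‖U t F - Θ (U t F)‖) - t₀ * (2 * δ) := by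
    rw [intervalIntegral.integral_sub hfi intervalIntegrable_const, intervalIntegral.integral_const]
    simp
  have hhalf : ∫ t in (0:ℝ)..t₀, ‖U t F - Θ (U t F)‖ / 2 = (∫ t in (0:ℝ)..t₀, ‖U t F - Θ (U t F)‖) / 2 := by
    rw [intervalIntegral.integral_div]
  rw [hhalf] at hper
  rw [hsplit] at hI
  linarith

end

end Summit.AtomisticToContinuum.FouriersLaw.Theorems.OddPersistence
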